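import Mathlib
import Summits.AtomisticToContinuum.HydrodynamicLimit.Theorems.ImplosionDichotomyDenseExcursionPackingAnalyticOrderOne

/-!
# The first jet of the hard-sphere stiffening factor and the order-one source of `Γ` for `M = stiffening F`
# (crux `DenseExcursion`, stmt-AtomisticToContinuum-12586, line `packing-analytic-implosion`)

Helper file (`--supports stmt-AtomisticToContinuum-12586`, line lead a2, stub `stub_analyticPackingImplosion`).
The stub's stiffening law is `M = stiffening F = Π_F + (3/5) φ Π_F′`, `Π_F = e^{(2/3)F}(1 + φF′)`
(`…PackingAnalyticDefs.lean`). Kernel-checked here, for an excess free energy `F` that is `C²` at `0` with `F 0 = 0`: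

* `hasDerivAt_isentropePressureFactor_zero`: `Π_F′(0) = (5/3) F′(0)`;
* `hasDerivAt_stiffening_zero` (REGISTERED helper): `M_F′(0) = (8/3) F′(0)` — so `M_F′(0) = 16π/9` at the
  hard-sphere value `F′(0) = B₂ = 2π/3`, the number `m₁ = 5.5851` of the crux numerics (NUMERICS-i5b);
* `order_one_source_stiffening`: combining with the landed `order_one_of_analyticPackingImplosion`
  (`…PackingAnalyticOrderOne.lean`), the first `G`-coefficient `X₁ = (w₁, s₁)` of ANY witness of the stub's conclusion
  `AnalyticPackingImplosion r W S (stiffening F)` is a smooth centre-regular real pair solving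
  `μ w₁ − linW(w₁, s₁) = 8 F′(0) · S (S′ + S) e^{3x} S³`, `μ s₁ − linS(w₁, s₁) = 0` (`μ = 3(r−1)`), unique by
  `hierarchy_solution_unique` — the object the first Melnikov functional pairs against, with all constants pinned.

Elementary calculus (`HasDerivAt.exp/fun_mul`, `ContDiffAt.fderiv_right`; the term `φ · Π′(φ)` is differentiated
at `0` through continuity of `Π′` only, `hasDerivAt_const_mul_id_mul_of_continuousAt`). NOT here: `Γ` itself.
-/

noncomputable section

open Filter Set
open scoped Topology ContDiff

namespace Summit.AtomisticToContinuum.HydrodynamicLimit.Theorems.PackingAnalyticImplosion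

open Summit.AtomisticToContinuum.HydrodynamicLimit.Theorems.R2OneModeTwoConditions

/-- `φ ↦ c φ g(φ)` has derivative `c g(0)` at `0` as soon as `g` is continuous at `0`. [folklore] -/
theorem hasDerivAt_const_mul_id_mul_of_continuousAt {g : ℝ → ℝ} (c : ℝ) (hg : ContinuousAt g 0) :
    HasDerivAt (fun φ => c * φ * g φ) (c * g 0) 0 := by
  rw [hasDerivAt_iff_tendsto_slope]
  have he : ∀ φ ∈ ({0}ᶜ : Set ℝ), c * g φ = slope (fun φ => c * φ * g φ) 0 φ := by
    intro φ hφ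
    rw [Set.mem_compl_singleton_iff] at hφ
    rw [slope_def_field]
    field_simp
    ring
  refine Tendsto.congr' (eventually_nhdsWithin_of_forall he) ?_
  exact (hg.tendsto.const_mul c).mono_left nhdsWithin_le_nhds

/-- **`Π_F′(0) = (5/3) F′(0)`** for the isentrope pressure factor `Π_F = e^{(2/3)F}(1 + φF′)`, `F` of class `C²` at
`0` with `F 0 = 0`. [folklore] -/
theorem hasDerivAt_isentropePressureFactor_zero {F : ℝ → ℝ} (hF : ContDiffAt ℝ 2 F 0) (hF0 : F 0 = 0) :
    HasDerivAt (isentropePressureFactor F) (5 / 3 * deriv F 0) 0 := by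
  have hFd : DifferentiableAt ℝ F 0 := hF.differentiableAt (by norm_num)
  have hF' : ContDiffAt ℝ 1 (deriv F) 0 :=
    (hF.fderiv_right (m := 1) (by norm_num)).clm_apply contDiffAt_const
  have hF'd : DifferentiableAt ℝ (deriv F) 0 := hF'.differentiableAt (by norm_num)
  have h1 : HasDerivAt (fun φ => Real.exp (2 / 3 * F φ)) (Real.exp (2 / 3 * F 0) * (2 / 3 * deriv F 0)) 0 :=
    (hFd.hasDerivAt.const_mul (2 / 3)).exp
  have h2 := ((hasDerivAt_id' (0 : ℝ)).fun_mul hF'd.hasDerivAt).const_add 1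
  have h := h1.fun_mul h2
  show HasDerivAt (fun φ => Real.exp (2 / 3 * F φ) * (1 + φ * deriv F φ)) _ 0
  refine h.congr_deriv ?_
  simp [hF0]
  ring

/-- The isentrope pressure factor of a `C²` free energy is `C¹` at `0`. [folklore] -/
theorem contDiffAt_one_isentropePressureFactor {F : ℝ → ℝ} (hF : ContDiffAt ℝ 2 F 0) :
    ContDiffAt ℝ 1 (isentropePressureFactor F) 0 := by
  have hF1 : ContDiffAt ℝ 1 F 0 := hF.of_le (by norm_num)
  have hF' : ContDiffAt ℝ 1 (deriv F) 0 :=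
    (hF.fderiv_right (m := 1) (by norm_num)).clm_apply contDiffAt_const
  show ContDiffAt ℝ 1 (fun φ => Real.exp (2 / 3 * F φ) * (1 + φ * deriv F φ)) 0
  exact (contDiffAt_const.mul hF1).exp.mul (contDiffAt_const.add (contDiffAt_id.mul hF'))

/-- **THE FIRST JET OF THE STIFFENING FACTOR** (registered helper `hasDerivAt_stiffening_zero`):
`M_F′(0) = (8/3) F′(0)` for `M_F = Π_F + (3/5) φ Π_F′`, `F` of class `C²` at `0` with `F 0 = 0`
(`M_F′(0) = Π_F′(0) + (3/5)Π_F′(0) = (8/5)(5/3)F′(0)`; `= 16π/9` at the hard-sphere `F′(0) = 2π/3`). [folklore] -/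
theorem hasDerivAt_stiffening_zero :
    ∀ (F : ℝ → ℝ), ContDiffAt ℝ 2 F 0 → F 0 = 0 → HasDerivAt (stiffening F) (8 / 3 * deriv F 0) 0 := by
  intro F hF hF0
  have hPi := hasDerivAt_isentropePressureFactor_zero hF hF0
  have hPic : ContinuousAt (deriv (isentropePressureFactor F)) 0 :=
    (((contDiffAt_one_isentropePressureFactor hF).fderiv_right (m := 0) (by norm_num)).clm_apply
      contDiffAt_const).continuousAt
  have h3 := hasDerivAt_const_mul_id_mul_of_continuousAt (3 / 5) hPic
  rw [hPi.deriv] at h3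
  show HasDerivAt (fun φ => isentropePressureFactor F φ +
    3 / 5 * φ * deriv (isentropePressureFactor F) φ) _ 0
  refine (hPi.fun_add h3).congr_deriv ?_
  ring

/-- `M_F′(0) = (8/3) F′(0)` in `deriv` form, and differentiability of `M_F` at `0`. [folklore] -/
theorem deriv_stiffening_zero {F : ℝ → ℝ} (hF : ContDiffAt ℝ 2 F 0) (hF0 : F 0 = 0) :
    DifferentiableAt ℝ (stiffening F) 0 ∧ deriv (stiffening F) 0 = 8 / 3 * deriv F 0 :=
  ⟨(hasDerivAt_stiffening_zero F hF hF0).differentiableAt, (hasDerivAt_stiffening_zero F hF hF0).deriv⟩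

/-- **THE ORDER-ONE SOURCE OF `Γ` FOR THE HARD-SPHERE STIFFENING LAW.** For any witness of the stub's conclusion
`AnalyticPackingImplosion r W S (stiffening F)` (`F` of class `C²` at `0`, `F 0 = 0`), the first `G`-coefficient
`X₁ = (w₁, s₁) = ∂_G (w, s)|_{G=0}` is a smooth centre-regular real pair solving
`μ w₁ − linW(w₁, s₁) = 8 F′(0) · S (S′ + S) e^{3x} S³`, `μ s₁ − linS(w₁, s₁) = 0`, `μ = 3(r − 1)`;
unique by `hierarchy_solution_unique` (`k = 1`). [folklore] -/
theorem order_one_source_stiffening {r : ℝ} {W S F : ℝ → ℝ}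
    (h : AnalyticPackingImplosion r W S (stiffening F)) (hF : ContDiffAt ℝ 2 F 0) (hF0 : F 0 = 0) :
    ∃ w₁ s₁ : ℝ → ℝ, IsRegularPair (fun x => (w₁ x : ℂ)) (fun x => (s₁ x : ℂ)) ∧
      ∀ x, ((3 * (r - 1) : ℝ) : ℂ) * (w₁ x : ℂ) -
            linW r W S (fun y => (w₁ y : ℂ)) (fun y => (s₁ y : ℂ)) x =
          ((8 * deriv F 0 * (S x * (deriv S x + S x)) * (Real.exp (3 * x) * S x ^ 3) : ℝ) : ℂ) ∧
        ((3 * (r - 1) : ℝ) : ℂ) * (s₁ x : ℂ) -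
            linS r W S (fun y => (w₁ y : ℂ)) (fun y => (s₁ y : ℂ)) x = 0 := by
  obtain ⟨hd, hderiv⟩ := deriv_stiffening_zero hF hF0
  obtain ⟨w₁, s₁, hreg, hsol⟩ := order_one_of_analyticPackingImplosion h hd (stiffening_zero hF0)
  refine ⟨w₁, s₁, hreg, fun x => ⟨?_, (hsol x).2⟩⟩
  rw [(hsol x).1, hderiv]
  push_cast
  ring

end Summit.AtomisticToContinuum.HydrodynamicLimit.Theorems.PackingAnalyticImplosion

end
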